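import Summits.QuantumFields.BalabanUV.Beta.CombChartTransportLevel
import Summits.QuantumFields.BalabanUV.Beta.CombChartJointEnd
import Summits.QuantumFields.BalabanUV.Beta.D1BFx.ChartDefectWords

/-!
# `BalabanUV.Beta.CombChartTransportHessKer` — binder row D1 (OWNER an2), SPEC S-an2-g49-1 §1′ ∕ RULING R-D1-g49-1 (ii), the (L2′) `hG` CHART HALF AT EVERY LEVEL:
# **M‴'s ONE-STEP KERNEL `TbalOf Lc (JsB12CombShSym …) j` READ ON THE ROOTED bm CHART `coDressKBmAt ρ_c Lc (KInvStep Lc j)`** — the one-loop functional of the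
# chart-(III′) kernel `GcombSh Lc j` with ITS OWN chain-rule vertex IS the functional at the rooted bm step resolvent on the slot-transported, leg-dressed jets, for ALL `j`

WHY.  Under R-D1-g49-1 (ii) the road's (L2′) identification `hG : hessKer (A_G j) (𝒱_G j) (𝒲_G j) = TbalOf Lc Js j` is stated at the tower's top-step chart
`A_G j = coDressKBmAt (toSite (rs 0)) Lc (KInvStep Lc (lev 0))` (#41d), while `TbalOf Lc (JsB12CombShSym …) j = hessKer (GcombSh Lc j) (vertexOfK (GcombSh Lc j) Lc S⁰_j) W⁰_j`
(`CombChartJointEnd.TbalOf_JsB12CombShSym`).  With the roots aligned (`rs 0 := ctrOff (d+1) Lc`) the two charts differ by the conjugation `GcombSh Lc j = Ψ̂_S ∘ A_G j ∘ Ψ̂_Sᵀ`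
(`CombChartTransportLevel.GcombSh_eq_conj_psiKS_KInvStep`, every `j`); d1-p2's (T1) `D1BFx/ChartDefectWords.hessKer_conj_psiKS_vertexOfK` (= `HessKerConjugation.hessKer_conj_kernel`
+ leaf-03's slot adjunction `SymCorrectorSlot.vertexOfK_conj_psiKS`) then moves `Ψ̂_S` onto the jets.  THIS FILE composes the two BY NAME: the chart half of `hG` is a THEOREM
at every level; what `hG` still needs is the identification of the transported jets with the tower's `(𝒱_G, 𝒲_G)` namings (the (S3-2) G bindings — an2's record letters at `j := lev 0`).

CONTENT ([folklore]; `[NeZero Lc]`, `ρ_c = ctr (d+1) Lc`, `Ψ̂_S = psiKS (ctrOff (d+1) Lc) Lc`, `G_j := coDressKBmAt ρ_c Lc (KInvStep Lc j)`).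
* §1 generic `d`: **`hessKer_GcombSh_vertexOfK_eq_bm (j) (hS : LocStencil S Cs δs) (hδs) (W′) (hW′) (μ ν z) :
  hessKer (GcombSh Lc j) (vertexOfK (GcombSh Lc j) Lc S) W′ μ ν z = hessKer G_j (μ y ↦ Ψ̂_Sᵀ ∘ vertexOfK G_j Lc (slotPsiS (ctrOff (d+1) Lc) Lc S) μ y ∘ Ψ̂_S) (μ y ν y′ ↦ Ψ̂_Sᵀ ∘ W′ μ y ν y′ ∘ Ψ̂_S) μ ν z`**.
* §2 `d = 3`, AT M‴'s LITERAL: **`TbalOf_JsB12CombShSym_eq_hessKer_bm (hLc : Odd Lc) (N tabs cΛ cB j) (μ ν z)`** — `TbalOf Lc (JsB12CombShSym hLc N tabs cΛ cB) j μ ν z` = the §1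
  right-hand side at `S := (JsB12CombSh0 … j).S`, `W′ := (JsB12CombSh0 … j).W` (their localisation letters are the `JetData` fields `loc ∕ δ_pos ∕ loc₂`).
WHAT THIS IS NOT: not `hG` (the jets' identification with the tower namings stays displayed); not (C1); nothing of Bałaban's asserted; 0 estimates; 0∕4 row-D1 binders
(hW, hR, D1Tel, D1Rep); NOT (T-ID), NOT D1, NEVER «G-an2-4 closed», NOT BetaPertH, NOT continuum, NOT Clay.

HONEST DEPENDENCY (page 1, mandatory): continuum YM on T⁴ ⇐ BetaPertH ∧ nine spine estimates (0/9 proved); BetaPertH ⇐ (D1) ∧ (D4) ∧ CAP+tail;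
G-an2-4 gates asym, D1 and NE2/3/4.  HONEST FRAMING (cell contract, verbatim): «discharging `BetaPertH` makes Bałaban's UV stability UNCONDITIONAL —
a real constructive-QFT result; it is NOT the continuum limit and NOT the Clay problem.»  ABSOLUTE RULE (cell charter, verbatim): «No internally-minted
statement may enter as a cited fact. Every hypothesis is either kernel-proved in this package or a verbatim quotation of a PUBLISHED theorem with page
reference. The manuscript(s) under audit are NOT citable for their own disputed steps — they are the thing under adjudication; programme-internal
(2001/route/tribunal) claims are never citable.»  [folklore] composition BY NAME; no `def`, no `def … : Prop`, nothing cited, 0 sorry.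
Row D1 OWNER an2 (b2b-balaban-beta-an2) gen 49, 2026-08-23.  No existing file touched.
-/

noncomputable section

namespace Summit.QuantumFields.BalabanUV.Beta.CombChartTransportHessKer

open Literature.MathematicalPhysics.QuantumFieldTheory
open Literature.MathematicalPhysics.QuantumFieldTheory.Balaban1983to89
open Literature.MathematicalPhysics.QuantumFieldTheory.Balaban1983to89.Beta
open ExpKernelCalculus (MKer comp hessKer)
open AffineAveraging (Site box)
open AveragingContoursRooted (ctr ctrOff ctrOff_mem_box)
open OneStepResolventKernel (Fib LocStencil JetData)
open OneStepKernelFamily (KInvStep vertexOfK TbalOf)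
open Summit.QuantumFields.BalabanUV.Beta.TameKernelCalculus (Spr Loc trK)
open Summit.QuantumFields.BalabanUV.Beta.AxialDressingRooted (coDressKBmAt spr_coDressKBmAt)
open Summit.QuantumFields.BalabanUV.Beta.BorderedHessian (spr_KInvStep)
open Summit.QuantumFields.BalabanUV.Beta.SymmetrisedStepJets (SymTables)
open Summit.QuantumFields.BalabanUV.Beta.CombChartStepJets (GcombSh JsB12CombSh0)
open Summit.QuantumFields.BalabanUV.Beta.CombChartJointEnd (JsB12CombShSym TbalOf_JsB12CombShSym)
open Summit.QuantumFields.BalabanUV.Beta.SymCorrectorKernel (psiKS)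
open Summit.QuantumFields.BalabanUV.Beta.SymCorrectorFace (slotPsiS)
open Summit.QuantumFields.BalabanUV.Beta.CombChartTransportLevel (GcombSh_eq_conj_psiKS_KInvStep)
open Summit.QuantumFields.BalabanUV.Beta.D1BFx.ChartDefectWords (hessKer_conj_psiKS_vertexOfK loc_jetData_W)

variable {d : ℕ}

/-! ## §1 The one-loop functional of the chart-(III′) kernel, read on the rooted bm chart, at every level -/

section Generic

variable (Lc : ℕ) [NeZero Lc]

/-- [folklore] **THE (L2′) `hG` CHART HALF AT LEVEL `j`, GENERIC JETS**: for a local stencil family `S` (`0 < δs`) and any localised second-order family `W′`,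
`hessKer (GcombSh Lc j) (vertexOfK (GcombSh Lc j) Lc S) W′ μ ν z
   = hessKer G_j (μ y ↦ Ψ̂_Sᵀ ∘ vertexOfK G_j Lc (slotPsiS (ctrOff (d+1) Lc) Lc S) μ y ∘ Ψ̂_S) (μ y ν y′ ↦ Ψ̂_Sᵀ ∘ W′ μ y ν y′ ∘ Ψ̂_S) μ ν z`,
`G_j = coDressKBmAt ρ_c Lc (KInvStep Lc j)` — `GcombSh_eq_conj_psiKS_KInvStep` (every `j`) + d1-p2's (T1) `hessKer_conj_psiKS_vertexOfK`. -/
theorem hessKer_GcombSh_vertexOfK_eq_bm (j : ℕ) {S : Fin (d + 1) → (Fin (d + 1) → ℤ) → MKer (d + 1) (Fib d)} {Cs δs : ℝ}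
    (hS : LocStencil S Cs δs) (hδs : 0 < δs) (W' : Fin (d + 1) → (Fin (d + 1) → ℤ) → Fin (d + 1) → (Fin (d + 1) → ℤ) → MKer (d + 1) (Fib d))
    (hW' : ∀ μ y ν y', Loc (W' μ y ν y')) (μ ν : Fin (d + 1)) (z : Fin (d + 1) → ℤ) :
    hessKer (GcombSh (d := d) Lc j) (vertexOfK (GcombSh (d := d) Lc j) Lc S) W' μ ν z
      = hessKer (coDressKBmAt (ctr (d + 1) Lc) Lc (KInvStep (d := d) Lc j))
          (fun μ' y => comp (comp (trK (psiKS (ctrOff (d + 1) Lc) Lc))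
            (vertexOfK (coDressKBmAt (ctr (d + 1) Lc) Lc (KInvStep (d := d) Lc j)) Lc (slotPsiS (ctrOff (d + 1) Lc) Lc S) μ' y)) (psiKS (ctrOff (d + 1) Lc) Lc))
          (fun μ' y ν' y' => comp (comp (trK (psiKS (ctrOff (d + 1) Lc) Lc)) (W' μ' y ν' y')) (psiKS (ctrOff (d + 1) Lc) Lc)) μ ν z := by
  have hLc : 0 < Lc := Nat.pos_of_ne_zero (NeZero.ne Lc)
  have hr : ctrOff (d + 1) Lc ∈ box (d + 1) Lc := ctrOff_mem_box hLc
  have hG : Spr (coDressKBmAt (ctr (d + 1) Lc) Lc (KInvStep (d := d) Lc j)) := spr_coDressKBmAt hLc hr (spr_KInvStep j)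
  rw [GcombSh_eq_conj_psiKS_KInvStep Lc j]
  exact hessKer_conj_psiKS_vertexOfK hLc hr hG hS hδs W' hW' μ ν z

end Generic

/-! ## §2 At M‴'s literal: the one-step kernel of record on the rooted bm chart -/

section Literal

variable {Lc : ℕ} [NeZero Lc]

/-- [folklore] **M‴'s ONE-STEP KERNEL AT LEVEL `j` ON THE ROOTED bm CHART** (`d = 3`; the (L2′) `hG` chart half under RULING R-D1-g49-1 (ii), every `j`):
`TbalOf Lc (JsB12CombShSym hLc N tabs cΛ cB) j μ ν z = hessKer G_j (μ y ↦ Ψ̂_Sᵀ ∘ vertexOfK G_j Lc (slotPsiS ρ Lc S⁰_j) μ y ∘ Ψ̂_S) (μ y ν y′ ↦ Ψ̂_Sᵀ ∘ W⁰_j μ y ν y′ ∘ Ψ̂_S) μ ν z`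
with `(S⁰_j, W⁰_j) := JsB12CombSh0 hLc N tabs cΛ cB j` (`CombChartJointEnd.TbalOf_JsB12CombShSym` + §1; the localisation letters are the `JetData` fields). -/
theorem TbalOf_JsB12CombShSym_eq_hessKer_bm (hLc : Odd Lc) (N : ℕ) (tabs : SymTables 3 Lc) (cΛ cB : ℝ) (j : ℕ) (μ ν : Fin 4) (z : Fin 4 → ℤ) :
    TbalOf Lc (JsB12CombShSym hLc N tabs cΛ cB) j μ ν z
      = hessKer (coDressKBmAt (ctr 4 Lc) Lc (KInvStep (d := 3) Lc j))
          (fun μ' y => comp (comp (trK (psiKS (ctrOff 4 Lc) Lc))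
            (vertexOfK (coDressKBmAt (ctr 4 Lc) Lc (KInvStep (d := 3) Lc j)) Lc
              (slotPsiS (ctrOff 4 Lc) Lc (JsB12CombSh0 hLc N tabs cΛ cB j).S) μ' y)) (psiKS (ctrOff 4 Lc) Lc))
          (fun μ' y ν' y' => comp (comp (trK (psiKS (ctrOff 4 Lc) Lc)) ((JsB12CombSh0 hLc N tabs cΛ cB j).W μ' y ν' y')) (psiKS (ctrOff 4 Lc) Lc)) μ ν z := by
  rw [TbalOf_JsB12CombShSym]
  exact hessKer_GcombSh_vertexOfK_eq_bm Lc j (JsB12CombSh0 hLc N tabs cΛ cB j).loc (JsB12CombSh0 hLc N tabs cΛ cB j).δ_pos _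
    (fun μ y ν y' => loc_jetData_W (JsB12CombSh0 hLc N tabs cΛ cB j) μ y ν y') μ ν z

end Literal

end Summit.QuantumFields.BalabanUV.Beta.CombChartTransportHessKer

end
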